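import Literature.Analysis.FunctionSpaces.TorusGradientLaplacianLp
import Mathlib.Analysis.SpecialFunctions.Sqrt
import HarnessLib

/-!
# `∂ᵢΔ⁻¹` is bounded on `L^p(T^d)` for every `1 ≤ p ≤ ∞`

Analysis/FunctionSpaces support file (everything proved; no definitions, no named facts). For the
mean-zero inverse Laplacian `Torus.invLaplacian` (`TorusInverseLaplacian`; Cheskidov–Luo 2022,
§7.2) we prove the part of Cheskidov–Luo 2022, Thm. 7.3 concerning the order `-1` operator
`Δ⁻¹∂ᵢ = ∂ᵢΔ⁻¹`: for every `1 ≤ p ≤ ∞` there is `K` with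

  `‖∂ᵢ Δ⁻¹g‖_{L^p(T^d)} ≤ K ‖g‖_{L^p(T^d)}`     for all smooth real `g`

(`Torus.exists_eLpNorm_partialDeriv_invLaplacian_le`), following the printed proof:
`1 < p < ∞` by Riesz transforms and Poincaré, `p = ∞` by the Sobolev (Morrey) embedding and Riesz
transforms at `q = d + 2` (`TorusGradientLaplacianLp`), and `p = 1` by duality — "one can use a
duality approach and use the boundedness in `L^∞` since integrating by parts yields
`⟨Tf, φ⟩ = -⟨f, Tφ⟩`". The duality step is elementary here: for smooth `h` the test functions
`φ_ε = h/√(h² + ε²)` are smooth with `|φ_ε| ≤ 1` and `∫ h φ_ε ≥ ∫ |h| - ε`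
(`Torus.eLpNorm_one_le_of_forall_integral_mul_le`), so no density argument is needed; the
adjoint identity uses integration by parts (a private copy of
`Torus.integral_partialDeriv_mul_eq_neg_integral` of `FluidPDE/TorusPressurePoisson`), the
symmetry `∫ (Δ⁻¹a) b = ∫ a (Δ⁻¹b)` (`Torus.integral_invLaplacian_mul_comm`, from Green's identity)
and `∂ᵢΔ⁻¹ = Δ⁻¹∂ᵢ` (`Torus.partialDeriv_invLaplacian`).

Also recorded, for the third-order operator `Δ⁻²∂ᵢ∂ⱼ∂ₖ` treated in
`FluidPDE/TorusLpOperatorFactsProofs`: the sup-norm bound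
`sup |∂ₗΔ⁻¹Δ⁻¹∂ⱼ∂ᵢψ| ≤ M ‖ψ‖_{L^∞}` (`Torus.exists_enorm_partialDeriv_invLaplacian_invLaplacian_le`).

## References

* A. Cheskidov, X. Luo, *Sharp nonuniqueness for the Navier–Stokes equations*, Invent. Math. 229
  (2022) = arXiv:2009.06596, §7.2, Thm. 7.3 and its proof. [`CheskidovLuo2022`]
* L. C. Evans, *Partial Differential Equations*, 2nd ed. (2010), App. C.2 Thm. 2 (integration
  by parts). [`Evans2010`]
-/

noncomputable section

open MeasureTheory Set Filter Function
open scoped ENNReal NNReal ContDiff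

namespace Literature.Analysis.FunctionSpaces

namespace Torus

variable {d : Type*} [Fintype d]

/-! ## Elementary `L^p` bookkeeping on the probability space `T^d` -/

section Bookkeeping

variable {F : Type*} [NormedAddCommGroup F]

/-- On the probability space `T^d`, the `L^p` norm of a constant is its norm (`p ≠ 0`). [folklore] -/
theorem eLpNorm_const_unitAddTorus (c : F) {p : ℝ≥0∞} (hp : p ≠ 0) :
    eLpNorm (fun _ : UnitAddTorus d => c) p volume = ‖c‖ₑ := by
  rw [eLpNorm_const c hp (NeZero.ne _), measure_univ, ENNReal.one_rpow, mul_one]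

/-- From a pointwise bound to the `L^∞` bound on `T^d`. [folklore] -/
theorem eLpNorm_top_le_of_forall_enorm_le {g : UnitAddTorus d → F} {C : ℝ≥0∞} (h : ∀ x, ‖g x‖ₑ ≤ C) :
    eLpNorm g ⊤ volume ≤ C := by
  rw [eLpNorm_exponent_top]
  exact eLpNormEssSup_le_of_ae_enorm_bound (Eventually.of_forall h)

/-- A continuous function on `T^d` is everywhere bounded by its `L^∞` norm (Haar measure charges
every nonempty open set). [folklore] -/
theorem enorm_le_eLpNorm_top_of_continuous {g : UnitAddTorus d → F} (hg : Continuous g) (x : UnitAddTorus d) :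
    ‖g x‖ₑ ≤ eLpNorm g ⊤ volume := by
  rw [eLpNorm_exponent_top]
  by_contra hlt
  push Not at hlt
  have hopen : IsOpen {y | eLpNormEssSup g volume < ‖g y‖ₑ} :=
    isOpen_lt continuous_const hg.enorm
  have hpos : 0 < volume {y | eLpNormEssSup g volume < ‖g y‖ₑ} :=
    hopen.measure_pos volume ⟨x, hlt⟩
  have hae := enorm_ae_le_eLpNormEssSup g (volume : Measure (UnitAddTorus d))
  rw [ae_iff] at hae
  exact hpos.ne' (by simpa only [not_le] using hae)

variable [NormedSpace ℝ F]

/-- On the probability space `T^d`, `‖∫ g‖ ≤ ‖g‖_{L^p}` for `1 ≤ p`. [folklore] -/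
theorem enorm_integral_le_eLpNorm {g : UnitAddTorus d → F} (hg : AEStronglyMeasurable g volume)
    {p : ℝ≥0∞} (hp : 1 ≤ p) : ‖∫ x, g x‖ₑ ≤ eLpNorm g p volume :=
  calc ‖∫ x, g x‖ₑ ≤ ∫⁻ x, ‖g x‖ₑ := enorm_integral_le_lintegral_enorm _
    _ = eLpNorm g 1 volume := eLpNorm_one_eq_lintegral_enorm.symm
    _ ≤ eLpNorm g p volume := eLpNorm_le_eLpNorm_of_exponent_le hp hg

/-- **Removing the mean costs a factor `2`**: `‖g - ∫ g‖_{L^p(T^d)} ≤ 2 ‖g‖_{L^p(T^d)}` for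
`1 ≤ p ≤ ∞`. [folklore] -/
theorem eLpNorm_sub_integral_le_two_mul {g : UnitAddTorus d → F} (hg : AEStronglyMeasurable g volume)
    {p : ℝ≥0∞} (hp : 1 ≤ p) :
    eLpNorm (fun x => g x - ∫ y, g y) p volume ≤ 2 * eLpNorm g p volume := by
  have hp0 : p ≠ 0 := (zero_lt_one.trans_le hp).ne'
  calc eLpNorm (fun x => g x - ∫ y, g y) p volume
      ≤ eLpNorm g p volume + eLpNorm (fun _ : UnitAddTorus d => ∫ y, g y) p volume :=
        eLpNorm_sub_le hg aestronglyMeasurable_const hp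
    _ ≤ eLpNorm g p volume + eLpNorm g p volume := by
        rw [eLpNorm_const_unitAddTorus _ hp0]
        exact add_le_add le_rfl (enorm_integral_le_eLpNorm hg hp)
    _ = 2 * eLpNorm g p volume := (two_mul _).symm

/-- A pairing against a pointwise bounded weight: `‖∫ g w‖ ≤ M ‖g‖_{L¹}` if `|w| ≤ M`. [folklore] -/
theorem enorm_integral_mul_le_of_forall_enorm_le {g w : UnitAddTorus d → ℝ} (hg : AEStronglyMeasurable g volume)
    {M : ℝ≥0∞} (hw : ∀ x, ‖w x‖ₑ ≤ M) : ‖∫ x, g x * w x‖ₑ ≤ M * eLpNorm g 1 volume := by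
  calc ‖∫ x, g x * w x‖ₑ ≤ ∫⁻ x, ‖g x * w x‖ₑ := enorm_integral_le_lintegral_enorm _
    _ ≤ ∫⁻ x, ‖g x‖ₑ * M := lintegral_mono fun x => by
        rw [enorm_mul]; exact mul_le_mul' le_rfl (hw x)
    _ = M * eLpNorm g 1 volume := by
        rw [lintegral_mul_const'' _ hg.enorm, mul_comm, eLpNorm_one_eq_lintegral_enorm]

end Bookkeeping

/-! ## Integration by parts, symmetry of `Δ⁻¹`, and the duality lemma -/

section Calculus

variable [DecidableEq d]

/-- **Integration by parts on the torus**: `∫ (∂ᵢa) b = -∫ a (∂ᵢb)` for smooth real `a`, `b`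
(`∫ ∂ᵢ(ab) = 0`, Evans, App. C.2 Thm. 2 with empty boundary; private copy of
`Torus.integral_partialDeriv_mul_eq_neg_integral` of `FluidPDE/TorusPressurePoisson`, whose heavy
import closure is not wanted here). [cite: Evans2010, App. C.2 Thm. 2] -/
private theorem integral_partialDeriv_mul_eq_neg {a b : UnitAddTorus d → ℝ} (ha : IsSmooth a) (hb : IsSmooth b)
    (i : d) : ∫ x, partialDeriv i a x * b x = -∫ x, a x * partialDeriv i b x := by
  have hab : IsSmooth (fun y => a y * b y) := by
    unfold IsSmooth at ha hb ⊢; exact ha.mul hb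
  have h0 : ∫ x, partialDeriv i (fun y => a y * b y) x = 0 := integral_partialDeriv_eq_zero_holds hab i
  have e : (fun x => partialDeriv i (fun y => a y * b y) x) =
      fun x => a x * partialDeriv i b x + partialDeriv i a x * b x :=
    funext fun x => partialDeriv_mul (ha.isContDiff (by simp)) (hb.isContDiff (by simp)) i x
  have hi1 : Integrable (fun x => a x * partialDeriv i b x) volume :=
    (ha.continuous.mul (hb.partialDeriv i).continuous).integrable_unitAddTorus
  have hi2 : Integrable (fun x => partialDeriv i a x * b x) volume :=
    ((ha.partialDeriv i).continuous.mul hb.continuous).integrable_unitAddTorus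
  rw [e, integral_add hi1 hi2] at h0
  linarith

/-- **`Δ⁻¹` is symmetric**: `∫ (Δ⁻¹a) b = ∫ a (Δ⁻¹b)` for smooth real `a`, `b` (write
`b = ΔΔ⁻¹b + ∫b`, `a = ΔΔ⁻¹a + ∫a`, use `∫ Δ⁻¹· = 0` and Green's second identity
`∫ θ Δφ = ∫ (Δθ) φ`). [folklore] -/
theorem integral_invLaplacian_mul_comm [Nonempty d] {a b : UnitAddTorus d → ℝ} (ha : IsSmooth a)
    (hb : IsSmooth b) : ∫ x, invLaplacian a x * b x = ∫ x, a x * invLaplacian b x := by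
  have hA : IsSmooth (invLaplacian a) := isSmooth_invLaplacian ha
  have hB : IsSmooth (invLaplacian b) := isSmooth_invLaplacian hb
  have hA0 : ∫ x, invLaplacian a x = 0 := integral_invLaplacian ha
  have hB0 : ∫ x, invLaplacian b x = 0 := integral_invLaplacian hb
  have e1 : (fun x => invLaplacian a x * b x) =
      fun x => invLaplacian a x * laplacian (invLaplacian b) x + (∫ y, b y) * invLaplacian a x := by
    funext x; rw [laplacian_invLaplacian hb x]; ring
  have e2 : (fun x => laplacian (invLaplacian a) x * invLaplacian b x) =
      fun x => a x * invLaplacian b x - (∫ y, a y) * invLaplacian b x := by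
    funext x; rw [laplacian_invLaplacian ha x]; ring
  have hi1 : Integrable (fun x => invLaplacian a x * laplacian (invLaplacian b) x) volume :=
    (hA.continuous.mul hB.laplacian.continuous).integrable_unitAddTorus
  have hi2 : Integrable (fun x => (∫ y, b y) * invLaplacian a x) volume :=
    (continuous_const.mul hA.continuous).integrable_unitAddTorus
  have hi3 : Integrable (fun x => a x * invLaplacian b x) volume :=
    (ha.continuous.mul hB.continuous).integrable_unitAddTorus
  have hi4 : Integrable (fun x => (∫ y, a y) * invLaplacian b x) volume :=
    (continuous_const.mul hB.continuous).integrable_unitAddTorus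
  rw [e1, integral_add hi1 hi2, integral_const_mul, hA0, mul_zero, add_zero,
    integral_mul_laplacian_comm_holds hA hB, e2, integral_sub hi3 hi4, integral_const_mul, hB0,
    mul_zero, sub_zero]

omit [DecidableEq d] in
/-- The scalar inequality behind the duality lemma: `|s| ≤ s²/√(s² + ε²) + ε` for `ε > 0`. [folklore] -/
theorem abs_le_sq_div_sqrt_add {ε : ℝ} (hε : 0 < ε) (s : ℝ) :
    |s| ≤ s * (s / Real.sqrt (s ^ 2 + ε ^ 2)) + ε := by
  have hr : 0 < Real.sqrt (s ^ 2 + ε ^ 2) := Real.sqrt_pos.2 (by positivity)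
  have hr1 : Real.sqrt (s ^ 2 + ε ^ 2) ≤ |s| + ε := by
    rw [Real.sqrt_le_iff]
    refine ⟨by positivity, ?_⟩
    nlinarith [abs_nonneg s, sq_abs s]
  have h1 : |s| - ε ≤ s ^ 2 / (|s| + ε) := by
    rw [le_div_iff₀ (by positivity)]
    nlinarith [sq_abs s]
  have h2 : s ^ 2 / (|s| + ε) ≤ s ^ 2 / Real.sqrt (s ^ 2 + ε ^ 2) :=
    div_le_div_of_nonneg_left (sq_nonneg s) hr hr1
  have h3 : s * (s / Real.sqrt (s ^ 2 + ε ^ 2)) = s ^ 2 / Real.sqrt (s ^ 2 + ε ^ 2) := by ring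
  linarith

omit [DecidableEq d] in
/-- **The duality lemma for smooth functions on `T^d`.** If `|∫ h φ| ≤ A` for every smooth real `φ`
with `|φ| ≤ 1`, then `‖h‖_{L¹(T^d)} ≤ A` — tested on `φ_ε = h/√(h² + ε²)`, which is smooth,
bounded by `1`, and has `∫ h φ_ε ≥ ∫ |h| - ε`. [folklore] -/
theorem eLpNorm_one_le_of_forall_integral_mul_le {h : UnitAddTorus d → ℝ} (hh : IsSmooth h) {A : ℝ≥0∞}
    (hA : ∀ φ : UnitAddTorus d → ℝ, IsSmooth φ → (∀ x, |φ x| ≤ 1) → ‖∫ x, h x * φ x‖ₑ ≤ A) :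
    eLpNorm h 1 volume ≤ A := by
  rcases eq_or_ne A ⊤ with hAt | hAt
  · rw [hAt]; exact le_top
  have hint : Integrable h volume := hh.integrable
  rw [eLpNorm_one_eq_lintegral_enorm, ← ofReal_integral_norm_eq_lintegral_enorm hint, ← ENNReal.ofReal_toReal hAt]
  refine ENNReal.ofReal_le_ofReal (le_of_forall_pos_le_add fun ε hε => ?_)
  -- the test function `φ_ε = h/√(h² + ε²)`
  set φ : UnitAddTorus d → ℝ := fun x => h x / Real.sqrt (h x ^ 2 + ε ^ 2) with hφ_def
  have hne : ∀ s : ℝ, Real.sqrt (s ^ 2 + ε ^ 2) ≠ 0 := fun s => (Real.sqrt_pos.2 (by positivity)).ne'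
  have hφs : IsSmooth φ := by
    have hF : ContDiff ℝ ∞ (fun s : ℝ => s / Real.sqrt (s ^ 2 + ε ^ 2)) :=
      contDiff_id.div
        (((contDiff_id.pow 2).add contDiff_const).sqrt fun s => (by positivity : (s ^ 2 + ε ^ 2) ≠ 0)) hne
    unfold IsSmooth at hh ⊢
    exact hF.comp hh
  have hφ1 : ∀ x, |φ x| ≤ 1 := by
    intro x
    rw [hφ_def]; dsimp only
    rw [abs_div, abs_of_pos (Real.sqrt_pos.2 (by positivity)), div_le_one (Real.sqrt_pos.2 (by positivity))]
    exact Real.abs_le_sqrt (by nlinarith)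
  have hpt : ∀ x, ‖h x‖ ≤ h x * φ x + ε := fun x => by
    rw [Real.norm_eq_abs]; exact abs_le_sq_div_sqrt_add hε (h x)
  have hre : ‖∫ x, h x * φ x‖ ≤ A.toReal := by
    have := hA φ hφs hφ1
    rwa [← ofReal_norm, ENNReal.ofReal_le_iff_le_toReal hAt] at this
  have hiφ : Integrable (fun x => h x * φ x) volume := (hh.continuous.mul hφs.continuous).integrable_unitAddTorus
  calc ∫ x, ‖h x‖ ≤ ∫ x, (h x * φ x + ε) := integral_mono hint.norm (hiφ.add (integrable_const ε)) hpt
    _ = (∫ x, h x * φ x) + ε := by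
        rw [integral_add hiφ (integrable_const ε), integral_const, probReal_univ, one_smul]
    _ ≤ ‖∫ x, h x * φ x‖ + ε := by gcongr; exact Real.le_norm_self _
    _ ≤ A.toReal + ε := by gcongr

end Calculus

/-! ## `∂ᵢΔ⁻¹` on `L^p`: the three regimes -/

section Gradient

variable [DecidableEq d] [Nonempty d]

/-- `1 < p < ∞`: `‖∂ᵢΔ⁻¹g‖_p ≤ K ‖g‖_p` for smooth real `g` (Riesz transforms and Poincaré,
`Torus.exists_eLpNorm_partialDeriv_le_laplacian`, with `ΔΔ⁻¹g = g - ∫g`).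
[cite: CheskidovLuo2022, §7.2 proof of Thm. 7.3] -/
theorem exists_eLpNorm_partialDeriv_invLaplacian_le_of_one_lt {p : ℝ≥0∞} (hp1 : 1 < p) (hp : p < ⊤) :
    ∃ K : ℝ≥0, ∀ g : UnitAddTorus d → ℝ, IsSmooth g → ∀ i : d,
      eLpNorm (partialDeriv i (invLaplacian g)) p volume ≤ K * eLpNorm g p volume := by
  obtain ⟨K, hK⟩ := exists_eLpNorm_partialDeriv_le_laplacian (d := d) hp1 hp
  refine ⟨K * 2, fun g hg i => ?_⟩
  have hu : IsSmooth (invLaplacian g) := isSmooth_invLaplacian hg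
  have e : laplacian (invLaplacian g) = fun x => g x - ∫ y, g y := funext (laplacian_invLaplacian hg)
  calc eLpNorm (partialDeriv i (invLaplacian g)) p volume
      ≤ K * eLpNorm (laplacian (invLaplacian g)) p volume := hK _ hu i
    _ ≤ K * (2 * eLpNorm g p volume) := by
        rw [e]; exact mul_le_mul' le_rfl (eLpNorm_sub_integral_le_two_mul hg.continuous.aestronglyMeasurable hp1.le)
    _ = ((K * 2 : ℝ≥0) : ℝ≥0∞) * eLpNorm g p volume := by push_cast; ring

/-- `p = ∞`, pointwise: `|∂ᵢΔ⁻¹g (x)| ≤ K ‖g‖_{L^∞}` for smooth real `g` and every `x` (Morrey and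
Riesz transforms at `q = d + 2`, `Torus.exists_enorm_partialDeriv_le_laplacian`, then
`‖ΔΔ⁻¹g‖_q ≤ 2‖g‖_q ≤ 2‖g‖_∞`). [cite: CheskidovLuo2022, §7.2 proof of Thm. 7.3] -/
theorem exists_enorm_partialDeriv_invLaplacian_le :
    ∃ K : ℝ≥0, ∀ g : UnitAddTorus d → ℝ, IsSmooth g → ∀ (i : d) (x : UnitAddTorus d),
      ‖partialDeriv i (invLaplacian g) x‖ₑ ≤ K * eLpNorm g ⊤ volume := by
  obtain ⟨K, hK⟩ := exists_enorm_partialDeriv_le_laplacian (d := d)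
  refine ⟨K * 2, fun g hg i x => ?_⟩
  have hu : IsSmooth (invLaplacian g) := isSmooth_invLaplacian hg
  have hq1 : (1 : ℝ≥0∞) ≤ ENNReal.ofReal ((Fintype.card d : ℝ) + 2) := (one_lt_card_add_two d).le
  have e : laplacian (invLaplacian g) = fun x => g x - ∫ y, g y := funext (laplacian_invLaplacian hg)
  have hgm : AEStronglyMeasurable g volume := hg.continuous.aestronglyMeasurable
  calc ‖partialDeriv i (invLaplacian g) x‖ₑ
      ≤ K * eLpNorm (laplacian (invLaplacian g)) (ENNReal.ofReal ((Fintype.card d : ℝ) + 2)) volume := hK _ hu i x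
    _ ≤ K * (2 * eLpNorm g (ENNReal.ofReal ((Fintype.card d : ℝ) + 2)) volume) := by
        rw [e]; exact mul_le_mul' le_rfl (eLpNorm_sub_integral_le_two_mul hgm hq1)
    _ ≤ K * (2 * eLpNorm g ⊤ volume) :=
        mul_le_mul' le_rfl (mul_le_mul' le_rfl (eLpNorm_le_eLpNorm_of_exponent_le le_top hgm))
    _ = ((K * 2 : ℝ≥0) : ℝ≥0∞) * eLpNorm g ⊤ volume := by push_cast; ring

/-- `p = ∞`: `‖∂ᵢΔ⁻¹g‖_{L^∞} ≤ K ‖g‖_{L^∞}` for smooth real `g`.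
[cite: CheskidovLuo2022, §7.2 proof of Thm. 7.3] -/
theorem exists_eLpNorm_top_partialDeriv_invLaplacian_le :
    ∃ K : ℝ≥0, ∀ g : UnitAddTorus d → ℝ, IsSmooth g → ∀ i : d,
      eLpNorm (partialDeriv i (invLaplacian g)) ⊤ volume ≤ K * eLpNorm g ⊤ volume := by
  obtain ⟨K, hK⟩ := exists_enorm_partialDeriv_invLaplacian_le (d := d)
  exact ⟨K, fun g hg i => eLpNorm_top_le_of_forall_enorm_le fun x => hK g hg i x⟩

/-- **The adjoint identity**: `∫ (∂ᵢΔ⁻¹g) φ = -∫ g (∂ᵢΔ⁻¹φ)` for smooth real `g`, `φ`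
(integration by parts, symmetry of `Δ⁻¹`, `Δ⁻¹∂ᵢ = ∂ᵢΔ⁻¹`; Cheskidov–Luo 2022, proof of
Thm. 7.3, `p = 1`: "integrating by parts yields `⟨Tf, φ⟩ = -⟨f, Tφ⟩`").
[cite: CheskidovLuo2022, §7.2 proof of Thm. 7.3] -/
theorem integral_partialDeriv_invLaplacian_mul {g φ : UnitAddTorus d → ℝ} (hg : IsSmooth g) (hφ : IsSmooth φ)
    (i : d) : ∫ x, partialDeriv i (invLaplacian g) x * φ x = -∫ x, g x * partialDeriv i (invLaplacian φ) x := by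
  have hu : IsSmooth (invLaplacian g) := isSmooth_invLaplacian hg
  rw [integral_partialDeriv_mul_eq_neg hu hφ i, integral_invLaplacian_mul_comm hg (hφ.partialDeriv i)]
  congr 2
  funext x
  rw [partialDeriv_invLaplacian hφ i x]

/-- `p = 1`: `‖∂ᵢΔ⁻¹g‖_{L¹} ≤ K ‖g‖_{L¹}` for smooth real `g`, by duality from the pointwise `L^∞`
bound. [cite: CheskidovLuo2022, §7.2 proof of Thm. 7.3] -/
theorem exists_eLpNorm_one_partialDeriv_invLaplacian_le :
    ∃ K : ℝ≥0, ∀ g : UnitAddTorus d → ℝ, IsSmooth g → ∀ i : d,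
      eLpNorm (partialDeriv i (invLaplacian g)) 1 volume ≤ K * eLpNorm g 1 volume := by
  obtain ⟨K, hK⟩ := exists_enorm_partialDeriv_invLaplacian_le (d := d)
  refine ⟨K, fun g hg i => ?_⟩
  have hh : IsSmooth (partialDeriv i (invLaplacian g)) := (isSmooth_invLaplacian hg).partialDeriv i
  refine eLpNorm_one_le_of_forall_integral_mul_le hh fun φ hφ hφ1 => ?_
  rw [integral_partialDeriv_invLaplacian_mul hg hφ i, enorm_neg]
  have hφtop : eLpNorm φ ⊤ volume ≤ 1 := eLpNorm_top_le_of_forall_enorm_le fun x => by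
    rw [← ofReal_norm, Real.norm_eq_abs, ← ENNReal.ofReal_one]
    exact ENNReal.ofReal_le_ofReal (hφ1 x)
  have hw : ∀ x, ‖partialDeriv i (invLaplacian φ) x‖ₑ ≤ K := fun x =>
    (hK φ hφ i x).trans (by simpa using mul_le_mul' (le_refl (K : ℝ≥0∞)) hφtop)
  exact enorm_integral_mul_le_of_forall_enorm_le hg.continuous.aestronglyMeasurable hw

/-- **`∂ᵢΔ⁻¹` is bounded on `L^p(T^d)` for every `1 ≤ p ≤ ∞`** (Cheskidov–Luo 2022, Thm. 7.3, the
operator `Δ⁻¹∂ᵢ`): for every `1 ≤ p` there is `K` with `‖∂ᵢΔ⁻¹g‖_{L^p} ≤ K ‖g‖_{L^p}` for all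
smooth real `g` and all `i` (the zero-mean restriction of the printed statement is not needed).
[cite: CheskidovLuo2022, §7.2 Thm. 7.3] -/
theorem exists_eLpNorm_partialDeriv_invLaplacian_le {p : ℝ≥0∞} (hp : 1 ≤ p) :
    ∃ K : ℝ≥0, ∀ g : UnitAddTorus d → ℝ, IsSmooth g → ∀ i : d,
      eLpNorm (partialDeriv i (invLaplacian g)) p volume ≤ K * eLpNorm g p volume := by
  rcases eq_or_lt_of_le hp with rfl | hp1
  · exact exists_eLpNorm_one_partialDeriv_invLaplacian_le
  rcases eq_or_lt_of_le (le_top : p ≤ ⊤) with rfl | hptop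
  · exact exists_eLpNorm_top_partialDeriv_invLaplacian_le
  exact exists_eLpNorm_partialDeriv_invLaplacian_le_of_one_lt hp1 hptop

/-! ## A sup-norm bound for `∂ₗΔ⁻¹Δ⁻¹∂ⱼ∂ᵢ` -/

/-- **`sup |∂ₗ Δ⁻¹Δ⁻¹∂ⱼ∂ᵢψ| ≤ M ‖ψ‖_{L^∞}`** for smooth real `ψ` (the sup-norm bound of
`Torus.exists_enorm_partialDeriv_le_laplacian` for `u = Δ⁻¹Ψ`, `Ψ = Δ⁻¹∂ⱼ∂ᵢψ = ∂ⱼ∂ᵢΔ⁻¹ψ`,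
then the Calderón–Zygmund bound for `∂ⱼ∂ᵢΔ⁻¹ψ` at `q = d + 2`): the `L^∞` ingredient of the
duality argument for the third-order operator `Δ⁻²∂ᵢ∂ⱼ∂ₖ` in Cheskidov–Luo 2022, Thm. 7.3.
[cite: CheskidovLuo2022, §7.2 proof of Thm. 7.3] -/
theorem exists_enorm_partialDeriv_invLaplacian_invLaplacian_le :
    ∃ M : ℝ≥0, ∀ ψ : UnitAddTorus d → ℝ, IsSmooth ψ → ∀ (l j i : d) (x : UnitAddTorus d),
      ‖partialDeriv l (invLaplacian (invLaplacian (partialDeriv j (partialDeriv i ψ)))) x‖ₑ ≤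
        M * eLpNorm ψ ⊤ volume := by
  set q : ℝ≥0∞ := ENNReal.ofReal ((Fintype.card d : ℝ) + 2) with hq_def
  have hq1 : (1 : ℝ≥0∞) < q := one_lt_card_add_two d
  obtain ⟨K, hK⟩ := exists_enorm_partialDeriv_le_laplacian (d := d)
  obtain ⟨C, hC⟩ := eLpNorm_hessian_le_laplacian_holds (d := d) q hq1 (by rw [hq_def]; exact ENNReal.ofReal_lt_top)
  refine ⟨K * 2 * (C * 2), fun ψ hψ l j i x => ?_⟩
  set Ψ := invLaplacian (partialDeriv j (partialDeriv i ψ)) with hΨ_def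
  have hψij : IsSmooth (partialDeriv j (partialDeriv i ψ)) := (hψ.partialDeriv i).partialDeriv j
  have hΨ : IsSmooth Ψ := isSmooth_invLaplacian hψij
  have hu : IsSmooth (invLaplacian Ψ) := isSmooth_invLaplacian hΨ
  have hψm : AEStronglyMeasurable ψ volume := hψ.continuous.aestronglyMeasurable
  -- `Ψ = ∂ⱼ∂ᵢΔ⁻¹ψ`
  have eΨ : Ψ = partialDeriv j (partialDeriv i (invLaplacian ψ)) := by
    funext y
    rw [hΨ_def, ← partialDeriv_invLaplacian (hψ.partialDeriv i) j y]
    congr 1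
    funext z
    exact (partialDeriv_invLaplacian hψ i z).symm
  have e1 : laplacian (invLaplacian Ψ) = fun y => Ψ y - ∫ z, Ψ z := funext (laplacian_invLaplacian hΨ)
  have e2 : laplacian (invLaplacian ψ) = fun y => ψ y - ∫ z, ψ z := funext (laplacian_invLaplacian hψ)
  have hΨq : eLpNorm Ψ q volume ≤ C * (2 * eLpNorm ψ ⊤ volume) := by
    rw [eΨ]
    calc eLpNorm (partialDeriv j (partialDeriv i (invLaplacian ψ))) q volume
        ≤ C * eLpNorm (laplacian (invLaplacian ψ)) q volume := hC _ (isSmooth_invLaplacian hψ) j i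
      _ ≤ C * (2 * eLpNorm ψ q volume) := by
          rw [e2]; exact mul_le_mul' le_rfl (eLpNorm_sub_integral_le_two_mul hψm hq1.le)
      _ ≤ C * (2 * eLpNorm ψ ⊤ volume) :=
          mul_le_mul' le_rfl (mul_le_mul' le_rfl (eLpNorm_le_eLpNorm_of_exponent_le le_top hψm))
  calc ‖partialDeriv l (invLaplacian Ψ) x‖ₑ
      ≤ K * eLpNorm (laplacian (invLaplacian Ψ)) q volume := hK _ hu l x
    _ ≤ K * (2 * eLpNorm Ψ q volume) := by
        rw [e1]; exact mul_le_mul' le_rfl (eLpNorm_sub_integral_le_two_mul hΨ.continuous.aestronglyMeasurable hq1.le)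
    _ ≤ K * (2 * (C * (2 * eLpNorm ψ ⊤ volume))) := mul_le_mul' le_rfl (mul_le_mul' le_rfl hΨq)
    _ = ((K * 2 * (C * 2) : ℝ≥0) : ℝ≥0∞) * eLpNorm ψ ⊤ volume := by push_cast; ring

end Gradient

end Torus

end Literature.Analysis.FunctionSpaces
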